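import Summits.KontsevichZagierPeriods.KontsevichZagierPeriods.Theorems.FurushoPentagonStuffleInKZ
import Summits.KontsevichZagierPeriods.KontsevichZagierPeriods.Theorems.FurushoPentagonHoffmanRelationInKZ
import Summits.KontsevichZagierPeriods.KontsevichZagierPeriods.Theorems.SectorToKernel.Negative.Anatomy
import Summits.KontsevichZagierPeriods.KontsevichZagierPeriods.Theorems.FurushoPentagonPentagonInKZ
import Summits.KontsevichZagierPeriods.KontsevichZagierPeriods.Theorems.FurushoPentagonDoubleShuffleInKZ
import Summits.KontsevichZagierPeriods.KontsevichZagierPeriods.Theorems.FurushoPentagonDoubleShuffleOfPentagon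
import Summits.KontsevichZagierPeriods.KontsevichZagierPeriods.Theorems.FurushoPentagonShuffleIsDissection
import Summits.KontsevichZagierPeriods.KontsevichZagierPeriods.Theorems.FurushoPentagonDualityInKZ
import Summits.KontsevichZagierPeriods.KontsevichZagierPeriods.Theorems.FurushoPentagonIntegerDivision
import Summits.KontsevichZagierPeriods.KontsevichZagierPeriods.Theorems.FurushoPentagonFurushoOverReduced
import Summits.KontsevichZagierPeriods.KontsevichZagierPeriods.Theorems.FurushoPentagonKernelImpliesReduced
import Summits.KontsevichZagierPeriods.KontsevichZagierPeriods.Theorems.FurushoPentagonAssembly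
import Literature.NumberTheory.Transcendental.KZRulesAssociator

/-!
# Strategist sibling audit — crux `SectorToKernel` (stmt-KontsevichZagierPeriods-10813), suspect = equivalence

Kernel-checked record for the crux-strategist verdict (unit `cstrat-stmt-KontsevichZagierPeriods-10813-q1`,
2026-08-17): the landed witness `sectorToKernel_iff_kontsevichZagierPeriods` (B ↔ S) is reconstructed here from
the Negative lane (`sectorToKernel_iff_summit_of_hyps`) and the two PROVED antecedent siblings, and the axiom
closure of the witness together with EVERY proved sibling of the route (`all_siblings`, queried with
`lean check --axioms`) is `{propext, Classical.choice, Quot.sound}` — no `sorryAx`, no ad-hoc axiom.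
Non-vacuity certificates: `KZ.relations ≠ ⊤` (soundness `KZ.relations_le_ker_eval_holds` + `value [pt,1] = 1`),
the pinned family `Z` of the `∀ Z, (pinning) → …` binders exists, admissible indices exist.
`deliverable_of_reduced`: the route's deliverable `DoubleShuffleInKZ` needs only `ReducedPeriodRing` through the
mechanism (and is in fact proved outright, `doubleShuffleInKZ_proof`).  Scratch-grade; theorems only.
-/

namespace Summit.KontsevichZagierPeriods.FurushoPentagon.SectorToKernel.StrategistAudit

open Literature.NumberTheory.Transcendental
open Summit.KontsevichZagierPeriods.KontsevichZagierPeriods.Theses.FurushoPentagon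

-- the witness (B ↔ S), from the Negative lane + the two proved antecedents
theorem witness_reconstructed : SectorToKernel ↔ KontsevichZagierPeriods :=
  Summit.KontsevichZagierPeriods.SectorToKernel.Negative.sectorToKernel_iff_summit_of_hyps
    Summit.KontsevichZagierPeriods.FurushoPentagon.StuffleInKZ.StuffleInKZ_of
    Summit.KontsevichZagierPeriods.FurushoPentagon.HoffmanRelationInKZ.hoffmanRelationInKZ_proof

-- non-vacuity 1: the relation subgroup is proper (soundness + value [pt,1] = 1), so "∈ KZ.relations" is not trivial.
example : (KZ.relations : AddSubgroup KZ.FormalRep) ≠ ⊤ := by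
  intro h
  have h1 : KZ.of KZ.IntegralRep.unit ∈ KZ.relations := by rw [h]; exact AddSubgroup.mem_top _
  have h2 : KZ.eval (KZ.of KZ.IntegralRep.unit) = 0 := KZ.relations_le_ker_eval_holds h1
  rw [KZ.eval_of, KZ.IntegralRep.value_unit] at h2
  exact one_ne_zero h2

-- non-vacuity 2: the pinned family Z exists (so the ∀ Z, (pinning) → … binders are inhabited).
example : ∃ Z : List ℕ → KZ.FormalRep, ∀ (u : List ℕ) (hu : MZV.IsAdmissible u),
    Z u = KZ.of (KZ.mzvRep u hu (KZ.mzvIntegrand_isSemialgebraicFunOn_holds u) (KZ.mzvIntegrand_integrableOn_holds u hu)) := by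
  classical
  exact ⟨fun u => if hu : MZV.IsAdmissible u then
      KZ.of (KZ.mzvRep u hu (KZ.mzvIntegrand_isSemialgebraicFunOn_holds u) (KZ.mzvIntegrand_integrableOn_holds u hu)) else 0,
    fun u hu => by simp [hu]⟩

-- non-vacuity 3: admissible indices exist (`#eval MZV.stuffle [2] [2]` prints `[[2, 2], [2, 2], [4]]`; not re-run here).
example : MZV.IsAdmissible [2] := by decide

-- the B ↔ S shape, reconstructed without the unbuilt OfItems module: see `witness_reconstructed` above.

/-- Conjunction of the witness and every proved sibling, for one `--axioms` closure query. -/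
theorem all_siblings :
    (SectorToKernel ↔ KontsevichZagierPeriods) ∧ PentagonInKZ ∧ HoffmanRelationInKZ ∧ StuffleInKZ ∧
    DoubleShuffleInKZ ∧ DoubleShuffleOfPentagon ∧ ShuffleIsDissection ∧ DualityInKZ ∧ IntegerDivision ∧
    FurushoOverReduced ∧ KernelImpliesReduced ∧ Assembly :=
  ⟨witness_reconstructed,
   Summit.KontsevichZagierPeriods.FurushoPentagon.PentagonInKZ.PentagonInKZ_of,
   Summit.KontsevichZagierPeriods.FurushoPentagon.HoffmanRelationInKZ.hoffmanRelationInKZ_proof,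
   Summit.KontsevichZagierPeriods.FurushoPentagon.StuffleInKZ.StuffleInKZ_of,
   Summit.KontsevichZagierPeriods.FurushoPentagon.DoubleShuffleInKZ.doubleShuffleInKZ_proof,
   Summit.KontsevichZagierPeriods.FurushoPentagon.DoubleShuffleOfPentagon.doubleShuffleOfPentagon_proof,
   Summit.KontsevichZagierPeriods.FurushoPentagon.ShuffleIsDissection.shuffleIsDissection_proof,
   Summit.KontsevichZagierPeriods.FurushoPentagon.DualityInKZ.DualityInKZ_proof,
   Summit.KontsevichZagierPeriods.FurushoPentagon.integerDivision_proof,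
   Summit.KontsevichZagierPeriods.FurushoPentagon.FurushoOverReduced.furushoOverReduced_proof,
   Summit.KontsevichZagierPeriods.FurushoPentagon.kernelImpliesReduced_proof,
   Summit.KontsevichZagierPeriods.FurushoPentagon.assembly_proof⟩

/-- What the mechanism has ALREADY delivered unconditionally except for ReducedPeriodRing:
the route's deliverable follows from the one open mechanism crux. -/
theorem deliverable_of_reduced (hR : ReducedPeriodRing) : DoubleShuffleInKZ :=
  Summit.KontsevichZagierPeriods.FurushoPentagon.DoubleShuffleOfPentagon.doubleShuffleOfPentagon_proof
    Summit.KontsevichZagierPeriods.FurushoPentagon.PentagonInKZ.PentagonInKZ_of hR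

end Summit.KontsevichZagierPeriods.FurushoPentagon.SectorToKernel.StrategistAudit
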